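import Summits.BirchSwinnertonDyer.BirchSwinnertonDyer.Theorems.ByReductionTypeAtTwoSupersingularFlatPTLayerKummerConjugates
import Summits.BirchSwinnertonDyer.BirchSwinnertonDyer.Theorems.EisensteinPrimesUnramifiedLeAwayKer
import Summits.BirchSwinnertonDyer.BirchSwinnertonDyer.Theorems.ThetaPartnerAtTwoSignedTransportAtTwoResidualLowerTools
import Summits.BirchSwinnertonDyer.Rank1Residual.X2.GreenbergVatsalUnramifiedAway
import Literature.NumberTheory.GaloisRepresentations.InertiaPrincipalConjugates
import Literature.NumberTheory.EllipticCurves.AnticyclotomicSignedCompactSelmer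
import Literature.NumberTheory.EllipticCurves.TwoVariableSelmerDual
import Literature.NumberTheory.EllipticCurves.BSDConductorProofs
import HarnessLib

/-!
# Route `ByReductionTypeAtTwo` (rung K4), crux `SupersingularRankZeroAtTwo` (item stmt-BirchSwinnertonDyer-19097), line
# `odd_blind_package` v2.18, stub `stub_flatPackage`, conjunct (8), clause F1♭ `Exact loc toX` — **THE TRANSFER BRICK (T♭)**: a
# layer class `s ∈ H¹(ℚ_n, W[p^k])` which is INTEGRAL at every `ℓ ≠ p`, locally trivial at `∞` and Kummer of a ♭-test point at
# `v ∣ p` restricts to `θ_{n,k}(s) ∈ Sel_{p^∞}(E/ℚ_∞)` — joints J3(ℓ), J3(∞), J3(p) of hand hF1♭-LEV — hence to `Sel♭(ℚ_∞)`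
# (★ p832362), and ORTH `w` gives `w(Q) ≡ 0 (mod p^k)` (★ p832084) (cell `bsd-2adic`, seat `bsd-2adic-t42` GEN 50, FILE 2;
# `--supports 19097`, helper)

HONEST FRAMING (D-0054): THEOREMS ONLY — no definition, no named fact, no instance, no notation, no `sorry`.  Helper toward
conjunct (8); closes NO stub; 19097 stays OPEN on its 5 registered stubs (v2.18); nothing is booked; BSD₂ is proved for no
supersingular curve and BSD for no curve by any of this; typed ≠ proved.  Generic prime `p`, no ×2; key-agnostic.

## What and why

The levelwise supplier (S-LEV) of T-LIM (`SSFlatPT.exists_snd_coleman_apply_eq_of_levelwise`, p831689) runs the finite-level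
Poitou–Tate converse over the layer `ℚ_n` in the Shapiro model (route S, the K2R0P♭ bricks `…PTDeep*`); its orthogonality check
needs, for every DUAL test class read as a layer class `b ∈ H¹(Γ_n, W[p^k])` satisfying the layer local conditions, that
`θ_{n,k}(b) := AcSigned.toInfty W p κ n k b ∈ H¹(ℚ_∞, E[p^∞])` lies in Sprung's `Sel♭(ℚ_∞)` — so that ORTH `w` applies.  Sprung's
`Sel♭` is the CLASSICAL `Sel_{p^∞}(E/ℚ_∞)` (`W.selmerInfty κ = W.selmerGroupOver p κ.kerSubgroup`: at every finite `u` and every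
`σ ∈ Γ_ℚ`, `conj_σ` of the class dies in `H¹((ker κ)_{ℚ_u}, E(ℚ̄_u))`, and the same at `∞`) cut by the ♭-Kummer condition at the
places above `v`.  Part J3(v) (★ p832084/p832362) supplied the ♭ condition and ASSUMED the classical membership `hsel`; this
file supplies `hsel` from LAYER data (the brick (T) of `SignedLowerOffTwo.PTDeep.levelwisePoitouTate_of_transfer`, ♭-twin,
with NO power of `p` lost: `m₀ = 0`):

* J3(ℓ) (§1–§2): if `s` is INTEGRAL AT `ℓ ≠ p` at the layer — `res_{Γ_n ⊓ I_𝔓} s = 0` for every prime `𝔓` of `ℤ̄` over `ℓ`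
  (Kato's `integralH1` clause, the currency of FIN/LEV) — then EVERY conjugate `conj_σ θ_{n,k}(s)` is UNRAMIFIED at the chosen
  place of `ℚ_∞` above `ℓ` (`GreenbergVatsal2000.unramifiedKer`; cocycles: `ψ(σ⁻¹ i|_{ℚ̄} σ) = (σ⁻¹ i σ)·b − b` on `I_{ℚ_ℓ}` by the
  tree's dialect bridge `exists_forall_absInertia_conj_apply_eq_of_forall_primesAbove`, whence `σ·ψ(σ⁻¹ x σ) = x·(σb) − σb`),
  hence LOCALLY TRIVIAL there for the cyclotomic `κ` (J3(a) = the tree's pro-prime-to-`p` engine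
  `UnramifiedLeAwayKer.unramifiedKer_le_awayKer_of_not_decomp_le` with `I_ℓ ≤ ker κ`, `D_ℓ ≰ ker κ`:
  `X2.GreenbergVatsalUnramifiedAway.{inertia,not_decomp}_le_kerSubgroup_of_isCyclotomic` — NO good-reduction hypothesis, the
  bad `ℓ` included), hence satisfies the classical local condition (`awayKer_le_localKerOver`).
* J3(∞)/J3(bad) (§3): if every conjugate of `s` dies on `Γ_n ⊓ D_w` (`w` infinite, resp. finite), so does every conjugate of
  `θ_{n,k}(s)` on `ker κ ⊓ D_w` (`infKer`, resp. `awayKer`), hence the classical condition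
  (`SignedTransportAtTwo.infKer_le_localKerOver`, `awayKer_le_localKerOver`).
* J3(p) + assembly (§4): with `layerLoc s = layerKummer Q` for a ♭-test point `Q` of level `k`, the ♭-local Kummer condition at
  every conjugate (★ `conjH1_toInfty_mem_sharpFlatLocalKummerOverOfEmb`, p832362) refines the classical one
  (`sharpFlatLocalKummerOverOfEmb_le_localKummerOverOfEmb`, `localKummerOverOfEmb_le_localKerOverOfEmb`); over `ℚ` the place above
  `p` is unique (`natCast_mem_asIdeal_iff_eq_primesEquiv_symm`).  Whence ★ `toInfty_mem_selmerInfty_of_integral_of_layerLoc_eq_layerKummer`,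
  ★★ `toInfty_mem_sharpFlatSelmerInfty_of_integral_of_layerLoc_eq_layerKummer`, and the (T♭) value statement
  ★★ `toZModPow_apply_eq_zero_of_orth_of_integral` (`ORTH w ⟹ w(Q) ≡ 0 mod p^k`).

References: [GreenbergLNM1716] §2 (pp. 69–72); [Greenberg1989] §1 p. 98 (3); [GreenbergVatsal2000] §2 p. 17; [Sprung2012] Def. 7.11
(p. 1503); [Kobayashi2003] §2 (p. 4), (8.23); [NeukirchANT1999] Ch. II §9 Prop. (9.6); [SerreGaloisCohomology1997] I §2.4–§2.5, I §5.8;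
[Kato2004Asterisque] §8.2 Lemma 8.5.
-/

set_option autoImplicit false
-- the Theorems namespace of this sub repeats the summit name by design (D-0017 nested layout)
set_option linter.dupNamespace false

noncomputable section

open scoped Classical NumberField

namespace Summit.BirchSwinnertonDyer.BirchSwinnertonDyer.Theorems

namespace SSFlatPT

open CategoryTheory NumberField IsDedekindDomain Field WeierstrassCurve ContinuousCohomology
  Literature.NumberTheory.EllipticCurves Literature.NumberTheory.GaloisRepresentations
  Literature.NumberTheory.EllipticCurves.GreenbergSelmer Literature.NumberTheory.EllipticCurves.GreenbergVatsal2000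
  Literature.NumberTheory.EllipticCurves.Sprung2012 Literature.NumberTheory.EllipticCurves.Sprung2017
  Literature.NumberTheory.EllipticCurves.Kobayashi2003 Literature.NumberTheory.EllipticCurves.Kato2004
  Summit.BirchSwinnertonDyer.Rank1Residual.X2 ZpExtension

variable (W : WeierstrassCurve ℚ) [W.IsElliptic] {p : ℕ} [Fact p.Prime] (κ : ZpExtension ℚ p)

/-! ## §1 J3(ℓ), inertia part: integral at `ℓ` at the layer ⟹ every conjugate of `θ_{n,k}(s)` is unramified above `ℓ` over `ℚ_∞` -/

omit [W.IsElliptic] in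
/-- **Integral at `ℓ` at the layer ⟹ `conj_σ θ_{n,k}(s)` unramified at the chosen place above `ℓ` over `ℚ_∞`, for EVERY `σ`.**
For `s ∈ H¹(Γ_n, W[p^k])` whose restriction to `Γ_n ⊓ I_𝔓` vanishes for every prime `𝔓` of `ℤ̄` above `ℓ` (Kato's `integralH1`
clause at `ℓ`), every conjugate `conj_σ (AcSigned.toInfty W p κ n k s)` lies in `GreenbergVatsal2000.unramifiedKer (ker κ) E[p^∞] ℓ`
(restriction to `ker κ ⊓ I_ℓ`, `I_ℓ = I_{ℚ_ℓ}|_{ℚ̄}`, vanishes): a representative `ψ` has `ψ(σ⁻¹ i|_{ℚ̄} σ) = (σ⁻¹ i σ)·b − b` on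
`I_{ℚ_ℓ}` (`exists_forall_absInertia_conj_apply_eq_of_forall_primesAbove`), so the conjugated cocycle `x ↦ σ·ψ(σ⁻¹xσ)` is the
coboundary of `σ·b` there. [cite: NeukirchANT1999, Ch. II §9 Prop. (9.6)] [cite: SerreGaloisCohomology1997, I §2.5]
[cite: Kato2004Asterisque, §8.2 Lemma 8.5 (pp. 183–184)] -/
theorem conjH1_toInfty_mem_unramifiedKer_of_forall_primesAbove (n k : ℕ)
    (s : W.torsionH1Over ((p : ℤ) ^ k) (κ.layerSubgroup n)) (ℓ : HeightOneSpectrum (𝓞 ℚ))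
    (hs : ∀ 𝔓 ∈ ℓ.primesAbove, resLe (W.torsionGaloisModule ((p : ℤ) ^ k)).toTopRep
      (inf_le_left : κ.layerSubgroup n ⊓ 𝔓.inertia (absoluteGaloisGroup ℚ) ≤ κ.layerSubgroup n) 1 s = 0)
    (σ : absoluteGaloisGroup ℚ) :
    conjH1 κ.kerSubgroup (W.geomPrimaryTorsion p) σ (AcSigned.toInfty W p κ n k s) ∈
      unramifiedKer κ.kerSubgroup (W.geomPrimaryTorsion p) ℓ := by
  obtain ⟨ψ, rfl⟩ := oneCocycleClass_surjective (discreteTopRep (κ.layerSubgroup n) (geomTorsion W ((p : ℤ) ^ k))) s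
  -- the dialect bridge: principal conjugates on `I_{ℚ_ℓ}` for the conjugator `σ`
  obtain ⟨b, hb⟩ := exists_forall_absInertia_conj_apply_eq_of_forall_primesAbove ℚ
    (W.torsionGaloisModule ((p : ℤ) ^ k)).toTopRep (κ.layerSubgroup n) ℓ ψ (fun 𝔓 h𝔓 ↦ hs 𝔓 h𝔓) σ
  -- unfold `conjH1 ∘ toInfty` on the cocycle and test on `ker κ ⊓ I_ℓ`
  rw [AcSigned.toInfty, resH1Hom_oneCocycleClass, Literature.NumberTheory.EllipticCurves.conjH1, resH1Hom_oneCocycleClass,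
    GreenbergVatsal2000.unramifiedKer, AddMonoidHom.mem_ker, CocycleCriteria.resH1Hom_oneCocycleClass_eq_zero_iff]
  refine ⟨AddSubgroup.inclusion (AcSigned.geomTorsion_zpow_le_geomPrimaryTorsion W p k) (σ • b), fun x ↦ ?_⟩
  -- `x = i|_{ℚ̄}` with `i ∈ I_{ℚ_ℓ}`, and `σ⁻¹ x σ ∈ ker κ ≤ Γ_n`
  obtain ⟨hxker, hxI⟩ := (mem_inertiaIn_iff κ.kerSubgroup ℓ (x : decomp (K := ℚ) ℓ)).1 x.2
  obtain ⟨i, hi, hix⟩ := Subgroup.mem_map.1 hxI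
  have hix' : absGaloisRestrict ℚ (ℓ.adicCompletion ℚ) i = ((x : decomp (K := ℚ) ℓ) : absoluteGaloisGroup ℚ) := hix
  have hconj : σ⁻¹ * ((x : decomp (K := ℚ) ℓ) : absoluteGaloisGroup ℚ) * σ ∈ κ.kerSubgroup :=
    Subgroup.Normal.conj_mem' inferInstance _ hxker σ
  have hd : σ⁻¹ * absGaloisRestrict ℚ (ℓ.adicCompletion ℚ) i * σ ∈ κ.layerSubgroup n := by
    rw [hix']
    exact κ.kerSubgroup_le_layerSubgroup n hconj
  have key := hb i hi hd
  -- the value of the conjugated cocycle at `x`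
  rw [pullback_resHomOfEquivariant_apply, pullback_resHomOfEquivariant_apply]
  have harg : subgroupInclusion (κ.kerSubgroup_le_layerSubgroup n)
      (subgroupConj κ.kerSubgroup σ (inertiaInToH κ.kerSubgroup ℓ x)) =
        ⟨σ⁻¹ * absGaloisRestrict ℚ (ℓ.adicCompletion ℚ) i * σ, hd⟩ := by
    apply Subtype.ext
    rw [subgroupInclusion_apply_coe, subgroupConj_apply_coe]
    change σ⁻¹ * ((x : decomp (K := ℚ) ℓ) : absoluteGaloisGroup ℚ) * σ = σ⁻¹ * absGaloisRestrict ℚ (ℓ.adicCompletion ℚ) i * σ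
    rw [hix']
  have hρ : ∀ (g : absoluteGaloisGroup ℚ) (m : geomTorsion W ((p : ℤ) ^ k)),
      (W.torsionGaloisModule ((p : ℤ) ^ k)).toTopRep.ρ g m = g • m := fun _ _ ↦ rfl
  rw [harg, key, hρ, hix']
  apply Subtype.ext
  simp only [AddMonoidHom.id_apply, DistribSMul.toAddMonoidHom_apply, Subgroup.smul_def, smul_sub, smul_smul,
    AddSubgroup.coe_inclusion, AddSubgroupClass.coe_sub, Literature.NumberTheory.EllipticCurves.primaryComponent.coe_smul,
    AddSubgroup.torsionBy.coe_smul, mul_assoc, mul_inv_cancel_left]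

/-! ## §2 J3(ℓ): locally trivial above `ℓ ≠ p` over `ℚ_∞` (cyclotomic tower), hence the classical local condition -/

omit [W.IsElliptic] in
/-- **J3(ℓ)**: for the CYCLOTOMIC `κ`, `ℓ ∤ p`, and a layer class `s` integral at `ℓ`, every conjugate `conj_σ θ_{n,k}(s)` is locally
trivial at the chosen place of `ℚ_∞` above `ℓ` (`GreenbergSelmer.awayKer`): §1 + the pro-prime-to-`p` engine
`UnramifiedLeAwayKer.unramifiedKer_le_awayKer_of_not_decomp_le` (`I_ℓ ≤ ker κ`, `D_ℓ ≰ ker κ` in the cyclotomic tower; `E[p^∞]` is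
`p`-primary with open stabilisers) — NO good-reduction hypothesis at `ℓ`. [cite: GreenbergVatsal2000, §2 p. 17]
[cite: Greenberg1989, §1 p. 98 (3)] [cite: GreenbergLNM1716, §2 (pp. 69–72)] -/
theorem conjH1_toInfty_mem_awayKer_of_forall_primesAbove (hκ : κ.IsCyclotomic) (n k : ℕ)
    (s : W.torsionH1Over ((p : ℤ) ^ k) (κ.layerSubgroup n)) (ℓ : HeightOneSpectrum (𝓞 ℚ)) (hℓ : ((p : ℕ) : 𝓞 ℚ) ∉ ℓ.asIdeal)
    (hs : ∀ 𝔓 ∈ ℓ.primesAbove, resLe (W.torsionGaloisModule ((p : ℤ) ^ k)).toTopRep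
      (inf_le_left : κ.layerSubgroup n ⊓ 𝔓.inertia (absoluteGaloisGroup ℚ) ≤ κ.layerSubgroup n) 1 s = 0)
    (σ : absoluteGaloisGroup ℚ) :
    conjH1 κ.kerSubgroup (W.geomPrimaryTorsion p) σ (AcSigned.toInfty W p κ n k s) ∈
      awayKer κ.kerSubgroup (W.geomPrimaryTorsion p) ℓ :=
  UnramifiedLeAwayKer.unramifiedKer_le_awayKer_of_not_decomp_le κ (W.isOpen_stabilizer_geomPrimaryTorsion' p)
    (W.exists_pow_smul_geomPrimaryTorsion_eq_zero p)
    (GreenbergVatsalUnramifiedAway.inertia_le_kerSubgroup_of_isCyclotomic κ ℓ hκ hℓ)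
    (GreenbergVatsalUnramifiedAway.not_decomp_le_kerSubgroup_of_isCyclotomic κ ℓ hκ hℓ)
    (conjH1_toInfty_mem_unramifiedKer_of_forall_primesAbove W κ n k s ℓ hs σ)

omit [W.IsElliptic] in
/-- **J3(ℓ), classical form**: under the same hypotheses, `conj_σ θ_{n,k}(s)` satisfies the classical local condition of
`Sel_{p^∞}(E/ℚ_∞)` at `ℓ` (`W.localKerOver`: it dies in `H¹((ker κ)_{ℚ_ℓ}, E(ℚ̄_ℓ))`; `awayKer_le_localKerOver`).
[cite: GreenbergLNM1716, §2 (pp. 69–72)] [cite: GreenbergVatsal2000, §2 p. 17] -/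
theorem conjH1_toInfty_mem_localKerOver_of_forall_primesAbove (hκ : κ.IsCyclotomic) (n k : ℕ)
    (s : W.torsionH1Over ((p : ℤ) ^ k) (κ.layerSubgroup n)) (ℓ : HeightOneSpectrum (𝓞 ℚ)) (hℓ : ((p : ℕ) : 𝓞 ℚ) ∉ ℓ.asIdeal)
    (hs : ∀ 𝔓 ∈ ℓ.primesAbove, resLe (W.torsionGaloisModule ((p : ℤ) ^ k)).toTopRep
      (inf_le_left : κ.layerSubgroup n ⊓ 𝔓.inertia (absoluteGaloisGroup ℚ) ≤ κ.layerSubgroup n) 1 s = 0)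
    (σ : absoluteGaloisGroup ℚ) :
    W.conjH1 p κ.kerSubgroup σ (AcSigned.toInfty W p κ n k s) ∈ W.localKerOver p κ.kerSubgroup (ℓ.adicCompletion ℚ) :=
  GreenbergVatsalUnramifiedAway.awayKer_le_localKerOver (v := ℓ) (W := W) (p := p) κ.kerSubgroup
    (conjH1_toInfty_mem_awayKer_of_forall_primesAbove W κ hκ n k s ℓ hℓ hs σ)

/-! ## §3 J3(∞) and J3(bad): local triviality on a decomposition group passes from the layer to `ℚ_∞` -/

omit [W.IsElliptic] in
/-- Restriction along a compatible pair preserves principal cocycles, on `θ_{n,k}`: if `conj_σ s` dies on `Γ_n ⊓ D` for a subgroup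
`D ≤ Γ_ℚ`, then `conj_σ θ_{n,k}(s)` dies on `ker κ ⊓ D`. [cite: SerreGaloisCohomology1997, I §2.4–§2.5] -/
theorem resOfLe_conjH1_toInfty_eq_zero_of_layer (n k : ℕ) (s : W.torsionH1Over ((p : ℤ) ^ k) (κ.layerSubgroup n))
    (D : Subgroup (absoluteGaloisGroup ℚ)) (σ : absoluteGaloisGroup ℚ)
    (h : resOfLe (geomTorsion W ((p : ℤ) ^ k)) (inf_le_left : κ.layerSubgroup n ⊓ D ≤ κ.layerSubgroup n)
      (conjH1 (κ.layerSubgroup n) (geomTorsion W ((p : ℤ) ^ k)) σ s) = 0) :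
    resOfLe (W.geomPrimaryTorsion p) (inf_le_left : κ.kerSubgroup ⊓ D ≤ κ.kerSubgroup)
      (conjH1 κ.kerSubgroup (W.geomPrimaryTorsion p) σ (AcSigned.toInfty W p κ n k s)) = 0 := by
  rw [← AcSigned.toInfty_conjH1]
  obtain ⟨χ, hχ⟩ := oneCocycleClass_surjective (discreteTopRep (κ.layerSubgroup n) (geomTorsion W ((p : ℤ) ^ k)))
    (conjH1 (κ.layerSubgroup n) (geomTorsion W ((p : ℤ) ^ k)) σ s)
  rw [← hχ] at h ⊢
  rw [resOfLe_oneCocycleClass_eq_zero_iff] at h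
  obtain ⟨a, ha⟩ := h
  rw [AcSigned.toInfty, resH1Hom_oneCocycleClass, resOfLe_oneCocycleClass_eq_zero_iff]
  refine ⟨AddSubgroup.inclusion (AcSigned.geomTorsion_zpow_le_geomPrimaryTorsion W p k) a, fun x ↦ ?_⟩
  rw [pullback_resHomOfEquivariant_apply]
  have hx : ((x : ↥(κ.kerSubgroup ⊓ D)) : absoluteGaloisGroup ℚ) ∈ κ.layerSubgroup n ⊓ D :=
    ⟨κ.kerSubgroup_le_layerSubgroup n x.2.1, x.2.2⟩
  have harg : subgroupInclusion (κ.kerSubgroup_le_layerSubgroup n)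
      (subgroupInclusion (inf_le_left : κ.kerSubgroup ⊓ D ≤ κ.kerSubgroup) x) =
        subgroupInclusion (inf_le_left : κ.layerSubgroup n ⊓ D ≤ κ.layerSubgroup n) ⟨_, hx⟩ := Subtype.ext rfl
  rw [harg, ha ⟨_, hx⟩]
  apply Subtype.ext
  simp only [AddSubgroup.coe_inclusion, AddSubgroupClass.coe_sub,
    Literature.NumberTheory.EllipticCurves.primaryComponent.coe_smul, AddSubgroup.torsionBy.coe_smul]

omit [W.IsElliptic] in
/-- **J3(∞)**: if every conjugate of the layer class `s` is locally trivial at the infinite place `w` (dies on `Γ_n ⊓ D_w`), then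
every conjugate of `θ_{n,k}(s)` satisfies the classical archimedean condition of `Sel_{p^∞}(E/ℚ_∞)` at `w` (`infKer` then
`SignedTransportAtTwo.infKer_le_localKerOver`).  At `p = 2` this clause is NOT idle. [cite: Greenberg1989, §1 p. 98 (3)]
[cite: GreenbergLNM1716, §2] -/
theorem conjH1_toInfty_mem_localKerOver_inf_of_layer (n k : ℕ) (s : W.torsionH1Over ((p : ℤ) ^ k) (κ.layerSubgroup n))
    (w : InfinitePlace ℚ) (σ : absoluteGaloisGroup ℚ)
    (h : resOfLe (geomTorsion W ((p : ℤ) ^ k)) (inf_le_left : κ.layerSubgroup n ⊓ decompInf w ≤ κ.layerSubgroup n)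
      (conjH1 (κ.layerSubgroup n) (geomTorsion W ((p : ℤ) ^ k)) σ s) = 0) :
    W.conjH1 p κ.kerSubgroup σ (AcSigned.toInfty W p κ n k s) ∈ W.localKerOver p κ.kerSubgroup w.Completion :=
  SignedTransportAtTwo.infKer_le_localKerOver W p κ.kerSubgroup w
    ((AddMonoidHom.mem_ker).2 (resOfLe_conjH1_toInfty_eq_zero_of_layer W κ n k s (decompInf w) σ h))

omit [W.IsElliptic] in
/-- **J3(bad), decomposition form**: if every conjugate of `s` is locally trivial at the FINITE place `ℓ` at the layer (dies on
`Γ_n ⊓ D_ℓ`), then every conjugate of `θ_{n,k}(s)` satisfies the classical local condition at `ℓ` over `ℚ_∞` (`awayKer` then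
`awayKer_le_localKerOver`) — the alternative input at a bad `ℓ` when the layer structure there is STRICT rather than unramified.
[cite: Greenberg1989, §1 p. 98 (3)] [cite: GreenbergLNM1716, §2] -/
theorem conjH1_toInfty_mem_localKerOver_of_layer_decomp (n k : ℕ) (s : W.torsionH1Over ((p : ℤ) ^ k) (κ.layerSubgroup n))
    (ℓ : HeightOneSpectrum (𝓞 ℚ)) (σ : absoluteGaloisGroup ℚ)
    (h : resOfLe (geomTorsion W ((p : ℤ) ^ k)) (inf_le_left : κ.layerSubgroup n ⊓ decomp ℓ ≤ κ.layerSubgroup n)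
      (conjH1 (κ.layerSubgroup n) (geomTorsion W ((p : ℤ) ^ k)) σ s) = 0) :
    W.conjH1 p κ.kerSubgroup σ (AcSigned.toInfty W p κ n k s) ∈ W.localKerOver p κ.kerSubgroup (ℓ.adicCompletion ℚ) :=
  GreenbergVatsalUnramifiedAway.awayKer_le_localKerOver (v := ℓ) (W := W) (p := p) κ.kerSubgroup
    ((AddMonoidHom.mem_ker).2 (resOfLe_conjH1_toInfty_eq_zero_of_layer W κ n k s (decomp ℓ) σ h))

/-! ## §4 J3(p) and the assembly: `θ_{n,k}(s) ∈ Sel_{p^∞}(E/ℚ_∞)`, `∈ Sel♭(ℚ_∞)`, and the (T♭) value statement -/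

variable (v : HeightOneSpectrum (𝓞 ℚ)) {ap : ℤ} {g : absoluteGaloisGroup (v.adicCompletion ℚ)}
  {c : ℕ → localPoints W (v.adicCompletion ℚ)}

/-- ★ **`θ_{n,k}(s) ∈ Sel_{p^∞}(E/ℚ_∞)` from layer data** (joints J3(ℓ) + J3(∞) + J3(p)).  For the cyclotomic `κ`, `v ∣ p`, a local
`g` restricting to a topological generator, `p ∣ a_p`, Honda levels `c_n` with the trace relations, and a layer class
`s ∈ H¹(Γ_n, W[p^k])` which is (i) INTEGRAL at every `ℓ ∤ p` (`res_{Γ_n ⊓ I_𝔓} s = 0`, all `𝔓 ∣ ℓ`), (ii) locally trivial at `∞` (all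
conjugates), (iii) Kummer at `v`: `layerLoc s = layerKummer Q` for a ♭-TEST point `Q ∈ E(ℚ_{n,v})` of level `k`, the class
`AcSigned.toInfty W p κ n k s` lies in `W.selmerInfty κ`: (i) §2; (ii) §3; (iii) the ♭-local Kummer condition at every conjugate
(`conjH1_toInfty_mem_sharpFlatLocalKummerOverOfEmb`, p832362) refines the classical one, and `v` is THE place of `ℚ` above `p`.
[cite: GreenbergLNM1716, §2 (pp. 69–72)] [cite: Sprung2012, Def. 7.11 (p. 1503)] [cite: Kobayashi2003, §2 (p. 4)] -/
theorem toInfty_mem_selmerInfty_of_integral_of_layerLoc_eq_layerKummer (hκ : κ.IsCyclotomic) (hv : ((p : ℕ) : 𝓞 ℚ) ∈ v.asIdeal)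
    (hap : (p : ℤ) ∣ ap) (hg : κ.IsTopGenerator (resGalOfEmb (closureEmb (K := ℚ) (v.adicCompletion ℚ)) g))
    (hc : ∀ n, c n ∈ localLayerPointsOfEmb κ (closureEmb (K := ℚ) (v.adicCompletion ℚ)) W n)
    (hTr : ∀ n, 1 ≤ n → localTraceOfEmb κ (closureEmb (K := ℚ) (v.adicCompletion ℚ)) W n (n + 1) (c (n + 1)) =
      ap • c n - c (n - 1))
    (n k : ℕ) (s : W.torsionH1Over ((p : ℤ) ^ k) (κ.layerSubgroup n))
    (hint : ∀ ℓ : HeightOneSpectrum (𝓞 ℚ), ((p : ℕ) : 𝓞 ℚ) ∉ ℓ.asIdeal → ∀ 𝔓 ∈ ℓ.primesAbove,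
      resLe (W.torsionGaloisModule ((p : ℤ) ^ k)).toTopRep
        (inf_le_left : κ.layerSubgroup n ⊓ 𝔓.inertia (absoluteGaloisGroup ℚ) ≤ κ.layerSubgroup n) 1 s = 0)
    (hinf : ∀ (w : InfinitePlace ℚ) (σ : absoluteGaloisGroup ℚ),
      resOfLe (geomTorsion W ((p : ℤ) ^ k)) (inf_le_left : κ.layerSubgroup n ⊓ decompInf w ≤ κ.layerSubgroup n)
        (conjH1 (κ.layerSubgroup n) (geomTorsion W ((p : ℤ) ^ k)) σ s) = 0)
    (Q : localPoints W (v.adicCompletion ℚ))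
    (hQ : Q ∈ localLayerPointsOfEmb κ (closureEmb (K := ℚ) (v.adicCompletion ℚ)) W n)
    (hkum : CyclotomicLayer.layerLoc W (p ^ k) κ v n s = CyclotomicLayer.layerKummer W (p ^ k) κ v n ⟨Q, hQ⟩)
    (htest : ∀ z' ∈ colemanKer κ (closureEmb (K := ℚ) (v.adicCompletion ℚ)) W ap g c .flat,
      (p : ℤ_[p]) ^ k ∣ z' ⟨Q, localLayerPointsOfEmb_le_localTowerPointsOfEmb κ _ W n hQ⟩) :
    AcSigned.toInfty W p κ n k s ∈ W.selmerInfty κ := by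
  rw [WeierstrassCurve.selmerInfty, WeierstrassCurve.mem_selmerGroupOver_iff]
  refine ⟨fun ℓ σ ↦ ?_, fun w σ ↦ conjH1_toInfty_mem_localKerOver_inf_of_layer W κ n k s w σ (hinf w σ)⟩
  by_cases hℓ : ((p : ℕ) : 𝓞 ℚ) ∈ ℓ.asIdeal
  · -- `ℓ = v`: the ♭-local Kummer condition refines the classical one
    have hp : (p : ℕ).Prime := Fact.out
    have hℓv : ℓ = v := by
      rw [natCast_mem_asIdeal_iff_eq_primesEquiv_symm _ hp] at hℓ hv
      exact hℓ.trans hv.symm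
    subst hℓv
    rw [WeierstrassCurve.localKerOver_eq_ofEmb]
    exact localKummerOverOfEmb_le_localKerOverOfEmb _
      (sharpFlatLocalKummerOverOfEmb_le_localKummerOverOfEmb _ _
        (conjH1_toInfty_mem_sharpFlatLocalKummerOverOfEmb W κ ℓ hap hg hc hTr n k s Q hQ hkum htest σ))
  · exact conjH1_toInfty_mem_localKerOver_of_forall_primesAbove W κ hκ n k s ℓ hℓ (hint ℓ hℓ) σ

/-- ★★ **`θ_{n,k}(s) ∈ Sel♭(ℚ_∞)` from layer data** — `toInfty_mem_sharpFlatSelmerInfty_of_layerLoc_eq_layerKummer` (p832362) with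
its classical-Selmer hypothesis `hsel` DISCHARGED by `toInfty_mem_selmerInfty_of_integral_of_layerLoc_eq_layerKummer`.
[cite: Sprung2012, Def. 7.11 (p. 1503)] [cite: GreenbergLNM1716, §2] -/
theorem toInfty_mem_sharpFlatSelmerInfty_of_integral_of_layerLoc_eq_layerKummer (hκ : κ.IsCyclotomic)
    (hv : ((p : ℕ) : 𝓞 ℚ) ∈ v.asIdeal) (hap : (p : ℤ) ∣ ap)
    (hg : κ.IsTopGenerator (resGalOfEmb (closureEmb (K := ℚ) (v.adicCompletion ℚ)) g))
    (hc : ∀ n, c n ∈ localLayerPointsOfEmb κ (closureEmb (K := ℚ) (v.adicCompletion ℚ)) W n)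
    (hTr : ∀ n, 1 ≤ n → localTraceOfEmb κ (closureEmb (K := ℚ) (v.adicCompletion ℚ)) W n (n + 1) (c (n + 1)) =
      ap • c n - c (n - 1))
    (n k : ℕ) (s : W.torsionH1Over ((p : ℤ) ^ k) (κ.layerSubgroup n))
    (hint : ∀ ℓ : HeightOneSpectrum (𝓞 ℚ), ((p : ℕ) : 𝓞 ℚ) ∉ ℓ.asIdeal → ∀ 𝔓 ∈ ℓ.primesAbove,
      resLe (W.torsionGaloisModule ((p : ℤ) ^ k)).toTopRep
        (inf_le_left : κ.layerSubgroup n ⊓ 𝔓.inertia (absoluteGaloisGroup ℚ) ≤ κ.layerSubgroup n) 1 s = 0)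
    (hinf : ∀ (w : InfinitePlace ℚ) (σ : absoluteGaloisGroup ℚ),
      resOfLe (geomTorsion W ((p : ℤ) ^ k)) (inf_le_left : κ.layerSubgroup n ⊓ decompInf w ≤ κ.layerSubgroup n)
        (conjH1 (κ.layerSubgroup n) (geomTorsion W ((p : ℤ) ^ k)) σ s) = 0)
    (Q : localPoints W (v.adicCompletion ℚ))
    (hQ : Q ∈ localLayerPointsOfEmb κ (closureEmb (K := ℚ) (v.adicCompletion ℚ)) W n)
    (hkum : CyclotomicLayer.layerLoc W (p ^ k) κ v n s = CyclotomicLayer.layerKummer W (p ^ k) κ v n ⟨Q, hQ⟩)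
    (htest : ∀ z' ∈ colemanKer κ (closureEmb (K := ℚ) (v.adicCompletion ℚ)) W ap g c .flat,
      (p : ℤ_[p]) ^ k ∣ z' ⟨Q, localLayerPointsOfEmb_le_localTowerPointsOfEmb κ _ W n hQ⟩) :
    AcSigned.toInfty W p κ n k s ∈ sharpFlatSelmerInfty W κ (closureEmb (K := ℚ) (v.adicCompletion ℚ)) ap g c .flat :=
  toInfty_mem_sharpFlatSelmerInfty_of_layerLoc_eq_layerKummer W κ v hap hg hc hTr n k s
    (toInfty_mem_selmerInfty_of_integral_of_layerLoc_eq_layerKummer W κ v hκ hv hap hg hc hTr n k s hint hinf Q hQ hkum htest)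
    Q hQ hkum htest

/-- ★★ **The transfer (T♭), value form** — ORTH `w` read at the layer with NO loss of a power of `p`: for a functional `w` on
`E(ℚ_∞·ℚ_v)` whose Kummer values on ♭-Selmer data vanish (ORTH, the hypothesis of T-LIM's consumer, VERBATIM as in ★ p832084),
and a layer class `s ∈ H¹(Γ_n, W[p^k])` integral at every `ℓ ∤ p`, locally trivial at `∞` (all conjugates), with
`layerLoc s = layerKummer Q` for a ♭-test point `Q` of level `k`: **`w(Q) ≡ 0 (mod p^k)`** (`toZModPow k (w Q) = 0`).
This is the brick (T) of `SignedLowerOffTwo.PTDeep.levelwisePoitouTate_of_transfer` in the ♭ setting with `m₀ = 0`.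
[cite: Sprung2012, Def. 7.9 and Def. 7.11 (p. 1503)] [cite: Kobayashi2003, (8.23) (p. 18)] [cite: MilneADT2006, Ch. I Thm. 4.10 (b)] -/
theorem toZModPow_apply_eq_zero_of_orth_of_integral (hκ : κ.IsCyclotomic) (hv : ((p : ℕ) : 𝓞 ℚ) ∈ v.asIdeal)
    (hap : (p : ℤ) ∣ ap) (hg : κ.IsTopGenerator (resGalOfEmb (closureEmb (K := ℚ) (v.adicCompletion ℚ)) g))
    (hc : ∀ n, c n ∈ localLayerPointsOfEmb κ (closureEmb (K := ℚ) (v.adicCompletion ℚ)) W n)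
    (hTr : ∀ n, 1 ≤ n → localTraceOfEmb κ (closureEmb (K := ℚ) (v.adicCompletion ℚ)) W n (n + 1) (c (n + 1)) =
      ap • c n - c (n - 1))
    (w : localTowerPointsOfEmb κ (closureEmb (K := ℚ) (v.adicCompletion ℚ)) W →+ ℤ_[p])
    (hw : ∀ (s : sharpFlatSelmerInfty W κ (closureEmb (K := ℚ) (v.adicCompletion ℚ)) ap g c .flat)
      (φ : contOneCocycles (discreteTopRep κ.kerSubgroup (W.geomPrimaryTorsion p)))
      (Q : localPoints W (v.adicCompletion ℚ)) (k : ℕ)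
      (hQ : (p ^ k) • Q ∈ localTowerPointsOfEmb κ (closureEmb (K := ℚ) (v.adicCompletion ℚ)) W),
      oneCocycleClass (discreteTopRep κ.kerSubgroup (W.geomPrimaryTorsion p)) φ = (s : W.subgroupH1 p κ.kerSubgroup) →
      (∀ τ : localSubgroupOfEmb κ.kerSubgroup (closureEmb (K := ℚ) (v.adicCompletion ℚ)),
        pointsMapOfEmb W (closureEmb (K := ℚ) (v.adicCompletion ℚ))
            ((φ.1 (resGalSubgroupOfEmb κ.kerSubgroup _ τ) : W.geomPrimaryTorsion p) : W.geomPoints) =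
          (τ : absoluteGaloisGroup (v.adicCompletion ℚ)) • Q - Q) →
      PadicInt.toZModPow k (w ⟨(p ^ k) • Q, hQ⟩) = 0)
    (n k : ℕ) (s : W.torsionH1Over ((p : ℤ) ^ k) (κ.layerSubgroup n))
    (hint : ∀ ℓ : HeightOneSpectrum (𝓞 ℚ), ((p : ℕ) : 𝓞 ℚ) ∉ ℓ.asIdeal → ∀ 𝔓 ∈ ℓ.primesAbove,
      resLe (W.torsionGaloisModule ((p : ℤ) ^ k)).toTopRep
        (inf_le_left : κ.layerSubgroup n ⊓ 𝔓.inertia (absoluteGaloisGroup ℚ) ≤ κ.layerSubgroup n) 1 s = 0)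
    (hinf : ∀ (w : InfinitePlace ℚ) (σ : absoluteGaloisGroup ℚ),
      resOfLe (geomTorsion W ((p : ℤ) ^ k)) (inf_le_left : κ.layerSubgroup n ⊓ decompInf w ≤ κ.layerSubgroup n)
        (conjH1 (κ.layerSubgroup n) (geomTorsion W ((p : ℤ) ^ k)) σ s) = 0)
    (Q : localPoints W (v.adicCompletion ℚ))
    (hQ : Q ∈ localLayerPointsOfEmb κ (closureEmb (K := ℚ) (v.adicCompletion ℚ)) W n)
    (hkum : CyclotomicLayer.layerLoc W (p ^ k) κ v n s = CyclotomicLayer.layerKummer W (p ^ k) κ v n ⟨Q, hQ⟩)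
    (htest : ∀ z' ∈ colemanKer κ (closureEmb (K := ℚ) (v.adicCompletion ℚ)) W ap g c .flat,
      (p : ℤ_[p]) ^ k ∣ z' ⟨Q, localLayerPointsOfEmb_le_localTowerPointsOfEmb κ _ W n hQ⟩) :
    PadicInt.toZModPow k (w ⟨Q, localLayerPointsOfEmb_le_localTowerPointsOfEmb κ _ W n hQ⟩) = 0 :=
  toZModPow_apply_eq_zero_of_orth_of_layerLoc_eq_layerKummer W κ v w hw n k s
    (toInfty_mem_sharpFlatSelmerInfty_of_integral_of_layerLoc_eq_layerKummer W κ v hκ hv hap hg hc hTr n k s hint hinf Q hQ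
      hkum htest) Q hQ hkum

end SSFlatPT

end Summit.BirchSwinnertonDyer.BirchSwinnertonDyer.Theorems

end
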